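import Summits.PneNP.PneNP.Theorems.KarlinRubinMonotoneSufficesGreedyStep
import Summits.PneNP.PneNP.Theorems.KarlinRubinMonotoneSufficesGreedyCircuitMain
import Summits.PneNP.PneNP.Theorems.KarlinRubinMonotoneSufficesGreedyParamsS
import Summits.PneNP.PneNP.Theorems.KarlinRubinMonotoneSufficesGreedyParamsA
import Summits.PneNP.PneNP.Theorems.KarlinRubinMonotoneSufficesCoverMain

/-!
# Crux `MonotoneSuffices` (stmt-PneNP-18026), the GREEDY general detector — part 12: assembly

**The greedy theorem** (`karlinRubin_exists_B2_detector_greedy`): for every `δ ∈ (0,1/2)` and every `ε > 0` there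
is a family of fan-in-2 circuits on the edges of `Kₙ`, of size `≤ n^{(δ+ε) log₂ n}` eventually, whose
`G(n,1/2)`-acceptance probability plus planted-`⌈n^{1/2-δ}⌉`-clique rejection probability tends to `0`:
randomized greedy clique sampling (parts 0–11) with `2^{(δ+o(1)) log₂² n}` hard-wired trials.

This is the best general upper bound known for planted cliques below `√n` at this granularity; the exponent `δ` is
`(1 + 2δ)^{-1}` times the exponent `δ + 2δ²` of the best MONOTONE detector in the tree
(`karlinRubin_exists_monotone_detector_cover`). Consequences recorded here:
* `karlinRubin_monotoneSuffices_nonvacuous_greedy` — the hypothesis of the crux instance `(δ, s)` is SATISFIABLE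
  for every budget `s(n) ≥ n^{(δ+ε) log₂ n}`, so any quasi-polynomial planted-clique lower bound `n^{η log₂ n}`
  (QPH_η, the route's `PlantedCliqueQuasipolyHard`) can only hold with `η ≤ δ`; with the explicit-exponent
  corollary of the covering theorem this caps the exponent `a` obtainable for `MonotoneSuffices` from QPH at
  `⌊(δ+2δ²)/η⌋ + 1 ≥ ⌊1+2δ⌋ + 1 = 2`.
-/

set_option linter.dupNamespace false -- `Summit.PneNP.PneNP.…`: summit = sub-problem name (D-0017 single-conjunct layout)

namespace Summit.PneNP.PneNP.Theorems.MonotoneSuffices.Greedy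

open Filter Topology Finset Real
open scoped ENNReal
open Literature.Computability.Complexity
open Literature.Probability.RandomGraphs.PlantedClique
open Summit.PneNP.PneNP.Theorems.MonotoneSuffices.Room
open Summit.PneNP.PneNP.Theorems.MonotoneSuffices.Cover

/-! ### One `n`: the circuit, its size and its two errors -/

/-- **One `n`.** Under the base inequalities at `n` there is a fan-in-2 circuit of size `≤ n^{(δ+ε) log₂ n}` whose
null acceptance plus planted rejection probability is `≤ 10 e^{-(⌊log₂ n⌋+1)}`. [folklore] -/
theorem greedy_circuit_at {δ ε : ℝ} {n : ℕ} (hδ : 0 < δ) (hδ' : δ < 1 / 2) (hn : 2048 ≤ n)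
    (hkBig : 640 * (Nat.log 2 n + 1) ^ 6 ≤ ⌈(n : ℝ) ^ (1 / 2 - δ)⌉₊) (h6k : 6 * ⌈(n : ℝ) ^ (1 / 2 - δ)⌉₊ ≤ n)
    (hk2 : ⌈(n : ℝ) ^ (1 / 2 - δ)⌉₊ ^ 2 ≤ 4 * n) (hkSq : (n : ℝ) ^ (1 - 2 * δ) ≤ (⌈(n : ℝ) ^ (1 / 2 - δ)⌉₊ : ℝ) ^ 2)
    (hS1 : 6 * Real.logb 2 ((Nat.log 2 n : ℝ) + 1) + 2 ≤ 4.5 + (1 / 2 - δ) * Real.logb 2 n)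
    (hS2 : 64 + 26 * Real.logb 2 ((Nat.log 2 n : ℝ) + 1) ≤ ε * Real.logb 2 n) :
    ∃ C : Circuit ((⊤ : SimpleGraph (Fin n)).edgeSet), C.IsOver B2 ∧
      ((C.size : ℝ) ≤ (n : ℝ) ^ ((δ + ε) * Real.logb 2 n)) ∧
      (erdosRenyiHalf n).toOuterMeasure {x | C.eval x = true} +
        (plantedCliqueDist n ⌈(n : ℝ) ^ (1 / 2 - δ)⌉₊).toOuterMeasure {x | C.eval x = false} ≤
        ENNReal.ofReal (10 * Real.exp (-((Nat.log 2 n : ℝ) + 1))) := by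
  classical
  -- parameters
  set k : ℕ := ⌈(n : ℝ) ^ (1 / 2 - δ)⌉₊ with hk
  set L : ℕ := Nat.log 2 n with hL
  set Q : ℕ := n * (L + 1) ^ 6 / k ^ 2 + 1 with hQ
  set t : ℕ := Nat.log 2 Q + 1 with ht
  set M : ℕ := 4 * n / k + 1 with hM
  set θ : ℕ := n / 2 ^ t + k / 4 + 1 with hθ
  obtain ⟨hQt, ht2Q, hQk, -, ht1, ht7, h160, h4n, hMn, htMk, h2tk, -, hnL, hL11, -, h32, -⟩ :=
    natFacts6 hL hQ ht hM hn hkBig h6k hk2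
  have hn0 : 0 < n := by omega
  have hk0 : 0 < k := by omega
  have hkn : k ≤ n := by omega
  have htn : t ≤ n := by omega
  have hM3 : M + 3 ≤ n := by
    have : M ≤ t * M := Nat.le_mul_of_pos_left M (by omega)
    omega
  -- the tables and the circuit
  obtain ⟨cs, hcs⟩ := greedy_counts (θ := θ) hδ hL hQ ht hM hθ hn hkBig h6k hk2
  obtain ⟨C, hCB, hCs, hCe⟩ := exists_detOut_circuit cs θ
  refine ⟨C, hCB, ?_, ?_⟩
  · -- size
    set s₁ : ℝ := ((k : ℝ) / (16 * n)) ^ t * 2 ^ (t * (t - 1) / 2) with hs₁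
    set R : ℕ := ⌈((L : ℝ) + 1) / s₁⌉₊ with hR
    obtain ⟨hs0, hs1, -, -⟩ := threading6 (M := M) hn0 h2tk (by omega) h4n
    have hRbound : (R : ℝ) + 1 ≤ ((L : ℝ) + 3) * ((16 * (n : ℝ) / k) ^ t / (2 : ℝ) ^ (t * (t - 1) / 2)) := by
      have hRhi : (R : ℝ) < ((L : ℝ) + 1) / s₁ + 1 := Nat.ceil_lt_add_one (by positivity)
      have hinv : ((16 * (n : ℝ) / k) ^ t / (2 : ℝ) ^ (t * (t - 1) / 2)) = 1 / s₁ := by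
        rw [hs₁, one_div, mul_inv, ← inv_pow, inv_div, div_eq_mul_inv]
      rw [hinv]
      have h2 : 2 ≤ 2 / s₁ := by rw [le_div_iff₀ hs0]; nlinarith
      have hL0 : (0 : ℝ) ≤ L := Nat.cast_nonneg L
      calc (R : ℝ) + 1 ≤ ((L : ℝ) + 1) / s₁ + 2 := by linarith
        _ ≤ ((L : ℝ) + 1) / s₁ + 2 / s₁ := by linarith
        _ = ((L : ℝ) + 3) * (1 / s₁) := by ring
    have hsize := greedySize_le (ε := ε) (Q := Q) (M := M) hδ hδ' ht2Q hQk hk2 hn hL11 hk0 htn hM3 hkSq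
      (rpow_le_k δ n) hS1 hS2 hRbound
    exact le_trans (by exact_mod_cast hCs) hsize
  · -- errors
    set e' : ℝ := Real.exp (-((L : ℝ) + 1)) with he'
    have he0 : 0 ≤ 5 * e' := by positivity
    have hP : (2 : ℝ) ^ Fintype.card (⊤ : SimpleGraph (Fin n)).edgeSet = Fintype.card (EdgeVec n) := by
      rw [Fintype.card_fun, Fintype.card_bool]; push_cast; ring
    have hCk0 : (0 : ℝ) < n.choose k := by exact_mod_cast Nat.choose_pos hkn
    -- type I
    have hI : (erdosRenyiHalf n).toOuterMeasure {x | C.eval x = true} ≤ ENNReal.ofReal (5 * e') := by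
      refine erdosRenyiHalf_le_ofReal _ he0 ?_
      have hset : (univ.filter fun x : EdgeVec n => x ∈ {x | C.eval x = true}) =
          univ.filter fun x : EdgeVec n => detOut x cs θ = true := by
        ext x; simp [hCe]
      rw [hset]
      have hnonneg : 0 ≤ ∑ A ∈ powersetCard k (univ : Finset (Fin n)),
          (#((univ : Finset (EdgeVec n)).filter fun z => detOut (plant A z) cs θ = false) : ℝ) :=
        sum_nonneg fun A _ => Nat.cast_nonneg _
      have h1 : (#((univ : Finset (EdgeVec n)).filter fun x => detOut x cs θ = true) : ℝ) * n.choose k ≤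
          (n.choose k : ℝ) * (2 ^ Fintype.card (⊤ : SimpleGraph (Fin n)).edgeSet * (5 * e')) := by nlinarith
      rw [mul_comm] at h1
      exact le_of_mul_le_mul_left h1 hCk0
    -- type II
    have hII : (plantedCliqueDist n k).toOuterMeasure {x | C.eval x = false} ≤ ENNReal.ofReal (5 * e') := by
      have hK : kSubsets n k = powersetCard k (univ : Finset (Fin n)) := by rw [kSubsets, min_eq_left hkn]
      have hfin : (plantedCliqueDist n k).toOuterMeasure {x | C.eval x = false} ≠ ⊤ :=
        ne_top_of_le_ne_top ENNReal.one_ne_top (by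
          calc (plantedCliqueDist n k).toOuterMeasure {x | C.eval x = false}
              ≤ (plantedCliqueDist n k).toOuterMeasure Set.univ := (plantedCliqueDist n k).toOuterMeasure.mono (Set.subset_univ _)
            _ = 1 := (PMF.toOuterMeasure_apply_eq_one_iff _ _).2 (Set.subset_univ _))
      rw [ENNReal.le_ofReal_iff_toReal_le hfin he0, plantedCliqueDist_toOuterMeasure_eq_sum, hK,
        ENNReal.toReal_mul, ENNReal.toReal_inv, ENNReal.toReal_natCast,
        ENNReal.toReal_sum (fun A _ => ne_top_of_le_ne_top ENNReal.one_ne_top (by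
          calc (erdosRenyiHalf n).toOuterMeasure {x | plant A x ∈ {x | C.eval x = false}}
              ≤ (erdosRenyiHalf n).toOuterMeasure Set.univ := (erdosRenyiHalf n).toOuterMeasure.mono (Set.subset_univ _)
            _ = 1 := (PMF.toOuterMeasure_apply_eq_one_iff _ _).2 (Set.subset_univ _)))]
      have hterm : ∀ A ∈ powersetCard k (univ : Finset (Fin n)),
          ((erdosRenyiHalf n).toOuterMeasure {x | plant A x ∈ {x | C.eval x = false}}).toReal =
            (#((univ : Finset (EdgeVec n)).filter fun z => detOut (plant A z) cs θ = false) : ℝ) / Fintype.card (EdgeVec n) := by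
        intro A _
        rw [erdosRenyiHalf_toOuterMeasure_eq_card_div, ENNReal.toReal_div, ENNReal.toReal_natCast, ENNReal.toReal_natCast]
        have hset : (univ.filter fun z : EdgeVec n => z ∈ {x | plant A x ∈ {x | C.eval x = false}}) =
            univ.filter fun z : EdgeVec n => detOut (plant A z) cs θ = false := by
          ext z; simp [hCe]
        rw [hset]
      rw [sum_congr rfl hterm, ← sum_div, card_powersetCard, card_univ, Fintype.card_fin]
      rw [inv_mul_le_iff₀ hCk0, div_le_iff₀ (by rw [← hP]; positivity), ← hP]
      have hnonneg : 0 ≤ (#((univ : Finset (EdgeVec n)).filter fun x => detOut x cs θ = true) : ℝ) * n.choose k := by positivity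
      nlinarith
    calc (erdosRenyiHalf n).toOuterMeasure {x | C.eval x = true} + (plantedCliqueDist n k).toOuterMeasure {x | C.eval x = false}
        ≤ ENNReal.ofReal (5 * e') + ENNReal.ofReal (5 * e') := add_le_add hI hII
      _ = ENNReal.ofReal (10 * e') := by rw [← ENNReal.ofReal_add he0 he0]; ring_nf

/-! ### The greedy theorem -/

/-- **The greedy theorem: a fan-in-2 strong detector of size `n^{(δ+ε) log₂ n}` for planted cliques below `√n`.**
For every `δ ∈ (0,1/2)` and `ε > 0` there is a family of circuits over `B₂` on the edges of `Kₙ` with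
`size ≤ n^{(δ+ε) log₂ n}` eventually whose `G(n,1/2)`-acceptance probability plus planted-`⌈n^{1/2-δ}⌉`-clique
rejection probability tends to `0` (randomized greedy clique sampling: `t ≈ 2δ log₂ n + 6 log₂ log₂ n` greedy picks
from hard-wired candidate lists, each pick uniform in the current common neighbourhood, so a trial threads the planted
clique with probability `≈ (k/16n)^t 2^{t(t-1)/2} = 2^{-(δ+o(1)) log₂² n}`; verify by counting common neighbours).
[folklore] -/
theorem karlinRubin_exists_B2_detector_greedy (δ ε : ℝ) (hδ : 0 < δ) (hδ' : δ < 1 / 2) (hε : 0 < ε) :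
    ∃ C : (n : ℕ) → Circuit ((⊤ : SimpleGraph (Fin n)).edgeSet),
      (∀ n, (C n).IsOver B2) ∧
      (∀ᶠ n : ℕ in atTop, ((C n).size : ℝ) ≤ (n : ℝ) ^ ((δ + ε) * Real.logb 2 n)) ∧
      Tendsto (fun n : ℕ => (erdosRenyiHalf n).toOuterMeasure {x | (C n).eval x = true} +
        (plantedCliqueDist n ⌈(n : ℝ) ^ (1 / 2 - δ)⌉₊).toOuterMeasure {x | (C n).eval x = false})
        atTop (𝓝 0) := by
  classical
  -- the good `n`
  let Good : ℕ → Prop := fun n => 2048 ≤ n ∧ 640 * (Nat.log 2 n + 1) ^ 6 ≤ ⌈(n : ℝ) ^ (1 / 2 - δ)⌉₊ ∧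
    6 * ⌈(n : ℝ) ^ (1 / 2 - δ)⌉₊ ≤ n ∧ ⌈(n : ℝ) ^ (1 / 2 - δ)⌉₊ ^ 2 ≤ 4 * n ∧
    (n : ℝ) ^ (1 - 2 * δ) ≤ (⌈(n : ℝ) ^ (1 / 2 - δ)⌉₊ : ℝ) ^ 2 ∧
    6 * Real.logb 2 ((Nat.log 2 n : ℝ) + 1) + 2 ≤ 4.5 + (1 / 2 - δ) * Real.logb 2 n ∧
    64 + 26 * Real.logb 2 ((Nat.log 2 n : ℝ) + 1) ≤ ε * Real.logb 2 n
  have hgood : ∀ᶠ n : ℕ in atTop, Good n := by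
    have hS1 := eventually_logSlack' (a := -(2.5 : ℝ)) (b := 6) (ε := 1 / 2 - δ) (by norm_num) (by linarith)
    have hS2 := eventually_logSlack' (a := (64 : ℝ)) (b := 26) (ε := ε) (by norm_num) hε
    filter_upwards [eventually_ge_atTop 2048, eventually_kBig6 hδ', eventually_sixK hδ, hS1, hS2] with n h1 h2 h3 h4 h5
    exact ⟨h1, h2, h3, kSq_le_four_mul hδ (by omega), rpow_le_kSq δ n, by linarith, h5⟩
  have hconst : ∀ n : ℕ, ∃ C : Circuit ((⊤ : SimpleGraph (Fin n)).edgeSet), C.IsOver B2 ∧ C.size ≤ 1 ∧ ∀ x, C.eval x = false :=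
    fun n => (cktSize_const _ false).toCircuit
  let C : (n : ℕ) → Circuit ((⊤ : SimpleGraph (Fin n)).edgeSet) := fun n =>
    if h : Good n then (greedy_circuit_at (ε := ε) hδ hδ' h.1 h.2.1 h.2.2.1 h.2.2.2.1 h.2.2.2.2.1 h.2.2.2.2.2.1 h.2.2.2.2.2.2).choose
    else (hconst n).choose
  have hC : ∀ n (h : Good n), C n = (greedy_circuit_at (ε := ε) hδ hδ' h.1 h.2.1 h.2.2.1 h.2.2.2.1 h.2.2.2.2.1 h.2.2.2.2.2.1 h.2.2.2.2.2.2).choose := by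
    intro n h; simp only [C, dif_pos h]
  refine ⟨C, fun n => ?_, ?_, ?_⟩
  · by_cases h : Good n
    · rw [hC n h]; exact (greedy_circuit_at (ε := ε) hδ hδ' h.1 h.2.1 h.2.2.1 h.2.2.2.1 h.2.2.2.2.1 h.2.2.2.2.2.1 h.2.2.2.2.2.2).choose_spec.1
    · simp only [C, dif_neg h]; exact (hconst n).choose_spec.1
  · filter_upwards [hgood] with n h
    rw [hC n h]
    exact (greedy_circuit_at (ε := ε) hδ hδ' h.1 h.2.1 h.2.2.1 h.2.2.2.1 h.2.2.2.2.1 h.2.2.2.2.2.1 h.2.2.2.2.2.2).choose_spec.2.1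
  · refine tendsto_of_tendsto_of_tendsto_of_le_of_le' tendsto_const_nhds (tendsto_ofReal_const_mul_exp_neg 10)
      (Eventually.of_forall fun n => bot_le) ?_
    filter_upwards [hgood] with n h
    rw [hC n h]
    exact (greedy_circuit_at (ε := ε) hδ hδ' h.1 h.2.1 h.2.2.1 h.2.2.2.1 h.2.2.2.2.1 h.2.2.2.2.2.1 h.2.2.2.2.2.2).choose_spec.2.2

/-! ### Consequence: the hypothesis of `MonotoneSuffices` is satisfiable at every budget `≥ n^{(δ+ε) log₂ n}` -/

/-- **Non-vacuity of the crux at quasi-polynomial budgets.** For `δ ∈ (0,1/2)`, `ε > 0` and every budget `s` with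
`n^{(δ+ε) log₂ n} ≤ s(n)` eventually, the HYPOTHESIS of the `MonotoneSuffices` instance `(δ, s)` holds: some `B₂`
family of size `≤ s(n)` eventually strongly detects the planted `⌈n^{1/2-δ}⌉`-clique. (So a lower bound
`n^{η log₂ n}` for such families forces `η ≤ δ`.) [folklore] -/
theorem karlinRubin_monotoneSuffices_nonvacuous_greedy (δ ε : ℝ) (hδ : 0 < δ) (hδ' : δ < 1 / 2) (hε : 0 < ε)
    (s : ℕ → ℕ) (hs : ∀ᶠ n : ℕ in atTop, (n : ℝ) ^ ((δ + ε) * Real.logb 2 n) ≤ s n) :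
    ∃ C : (n : ℕ) → Circuit ((⊤ : SimpleGraph (Fin n)).edgeSet),
      (∀ᶠ n : ℕ in atTop, (C n).IsOver B2 ∧ (C n).size ≤ s n) ∧
      Tendsto (fun n : ℕ => (erdosRenyiHalf n).toOuterMeasure {x | (C n).eval x = true} +
        (plantedCliqueDist n ⌈(n : ℝ) ^ (1 / 2 - δ)⌉₊).toOuterMeasure {x | (C n).eval x = false})
        atTop (𝓝 0) := by
  obtain ⟨C, hB, hsize, hT⟩ := karlinRubin_exists_B2_detector_greedy δ ε hδ hδ' hε
  refine ⟨C, ?_, hT⟩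
  filter_upwards [hsize, hs] with n h1 h2
  exact ⟨hB n, by exact_mod_cast h1.trans h2⟩

end Summit.PneNP.PneNP.Theorems.MonotoneSuffices.Greedy

namespace Summit.PneNP.PneNP.Theorems.MonotoneSuffices.Greedy

/-- Registered sub-goal `greedy_main` of stmt-PneNP-18026 (greedy detector, part 12): **the greedy theorem**
(fan-in-2 strong detector of size `n^{(δ+ε) log₂ n}` for planted `⌈n^{1/2-δ}⌉`-cliques), exported verbatim.
[folklore] -/
theorem greedy_main :
    ∀ (δ ε : ℝ), 0 < δ → δ < 1 / 2 → 0 < ε → ∃ C : (n : ℕ) → Literature.Computability.Complexity.Circuit ((⊤ : SimpleGraph (Fin n)).edgeSet), (∀ n, (C n).IsOver Literature.Computability.Complexity.B2) ∧ (∀ᶠ n : ℕ in Filter.atTop, ((C n).size : ℝ) ≤ (n : ℝ) ^ ((δ + ε) * Real.logb 2 n)) ∧ Filter.Tendsto (fun n : ℕ => (Literature.Probability.RandomGraphs.PlantedClique.erdosRenyiHalf n).toOuterMeasure {x | (C n).eval x = true} + (Literature.Probability.RandomGraphs.PlantedClique.plantedCliqueDist n ⌈(n : ℝ) ^ (1 /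 2 - δ)⌉₊).toOuterMeasure {x | (C n).eval x = false}) Filter.atTop (nhds 0) :=
  fun δ ε hδ hδ' hε => karlinRubin_exists_B2_detector_greedy δ ε hδ hδ' hε

end Summit.PneNP.PneNP.Theorems.MonotoneSuffices.Greedy
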